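import Summits.AtomisticToContinuum.Crystallization.Theorems.PalmUnimodularRigidityShellsToBarlowChartTransportOpsDefs

/-!
# Line `develop-the-model-growth-descent` (crux `ShellsToBarlowChart`, stmt-AtomisticToContinuum-9227): pattern facts, part 6

Decidable facts about the two integer kissing patterns `fcc3Int`, `hcpInt` (labels at squared
norm `18`) used by the frame transports of `stub_transportSystem`: hexagons, even/odd caps,
their filters, apexes, distance tables, lower caps and the letters read on them.  Every fact was
first verified by brute force (work/sim/facts.py of the lead's folder) and is proved here by
`decide` (split into small files so that each elaborates quickly).  All `[folklore]`
(finite checks on the cuboctahedron / anticuboctahedron, HalesDSP2012 §1.3).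
-/

namespace Summit.AtomisticToContinuum.Crystallization.Theorems.PalmUnimodularRigidityShellsToBarlowChart

open Literature.Geometry.DiscreteGeometry

/-- HCP: an equatorial label touches a mirror pair. [folklore] -/
theorem exists_mirror_pair_of_equatorial : ∀ ξ ∈ hcpInt, -ξ ∈ hcpInt → ∃ m ∈ hcpInt, ∃ n ∈ hcpInt, sqNormInt (ξ - m) = 18 ∧ sqNormInt (ξ - n) = 18 ∧ sqNormInt (m - n) = 48 := by
  decide

/-- evenCap: squared distances from the cap label `(c - a)` to the six hexagon labels. [folklore] -/
theorem dist_evenCap_ca : ∀ P : Finset (Fin 3 → ℤ), (P = fcc3Int ∨ P = hcpInt) →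
    ∀ a ∈ P, ∀ b ∈ P, ∀ c ∈ P, sqNormInt (a - b) = 18 → hexLabels a b ⊆ P → c ∉ hexLabels a b → c - a ∈ P → c - b ∈ P → sqNormInt ((c - a) - a) = 54 ∧ sqNormInt ((c - a) - b) = 36 ∧ sqNormInt ((c - a) - (b - a)) = 18 ∧ sqNormInt ((c - a) - (-a)) = 18 ∧ sqNormInt ((c - a) - (-b)) = 36 ∧ sqNormInt ((c - a) - (a - b)) = 54 := by
  rintro P (rfl | rfl) <;> decide

/-- evenCap: squared distances from the cap label `(c - b)` to the six hexagon labels. [folklore] -/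
theorem dist_evenCap_cb : ∀ P : Finset (Fin 3 → ℤ), (P = fcc3Int ∨ P = hcpInt) →
    ∀ a ∈ P, ∀ b ∈ P, ∀ c ∈ P, sqNormInt (a - b) = 18 → hexLabels a b ⊆ P → c ∉ hexLabels a b → c - a ∈ P → c - b ∈ P → sqNormInt ((c - b) - a) = 36 ∧ sqNormInt ((c - b) - b) = 54 ∧ sqNormInt ((c - b) - (b - a)) = 54 ∧ sqNormInt ((c - b) - (-a)) = 36 ∧ sqNormInt ((c - b) - (-b)) = 18 ∧ sqNormInt ((c - b) - (a - b)) = 18 := by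
  rintro P (rfl | rfl) <;> decide

/-- oddCap: squared distances from the cap label `c` to the six hexagon labels. [folklore] -/
theorem dist_oddCap_c : ∀ P : Finset (Fin 3 → ℤ), (P = fcc3Int ∨ P = hcpInt) →
    ∀ a ∈ P, ∀ b ∈ P, ∀ c ∈ P, sqNormInt (a - b) = 18 → hexLabels a b ⊆ P → c ∉ hexLabels a b → c + a ∈ P → c + b ∈ P → sqNormInt (c - a) = 54 ∧ sqNormInt (c - b) = 54 ∧ sqNormInt (c - (b - a)) = 36 ∧ sqNormInt (c - (-a)) = 18 ∧ sqNormInt (c - (-b)) = 18 ∧ sqNormInt (c - (a - b)) = 36 := by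
  rintro P (rfl | rfl) <;> decide

/-- oddCap: squared distances from the cap label `(c + a)` to the six hexagon labels. [folklore] -/
theorem dist_oddCap_ca : ∀ P : Finset (Fin 3 → ℤ), (P = fcc3Int ∨ P = hcpInt) →
    ∀ a ∈ P, ∀ b ∈ P, ∀ c ∈ P, sqNormInt (a - b) = 18 → hexLabels a b ⊆ P → c ∉ hexLabels a b → c + a ∈ P → c + b ∈ P → sqNormInt ((c + a) - a) = 18 ∧ sqNormInt ((c + a) - b) = 36 ∧ sqNormInt ((c + a) - (b - a)) = 54 ∧ sqNormInt ((c + a) - (-a)) = 54 ∧ sqNormInt ((c + a) - (-b)) = 36 ∧ sqNormInt ((c + a) - (a - b)) = 18 := by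
  rintro P (rfl | rfl) <;> decide

/-- oddCap: squared distances from the cap label `(c + b)` to the six hexagon labels. [folklore] -/
theorem dist_oddCap_cb : ∀ P : Finset (Fin 3 → ℤ), (P = fcc3Int ∨ P = hcpInt) →
    ∀ a ∈ P, ∀ b ∈ P, ∀ c ∈ P, sqNormInt (a - b) = 18 → hexLabels a b ⊆ P → c ∉ hexLabels a b → c + a ∈ P → c + b ∈ P → sqNormInt ((c + b) - a) = 36 ∧ sqNormInt ((c + b) - b) = 18 ∧ sqNormInt ((c + b) - (b - a)) = 18 ∧ sqNormInt ((c + b) - (-a)) = 36 ∧ sqNormInt ((c + b) - (-b)) = 54 ∧ sqNormInt ((c + b) - (a - b)) = 54 := by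
  rintro P (rfl | rfl) <;> decide
end Summit.AtomisticToContinuum.Crystallization.Theorems.PalmUnimodularRigidityShellsToBarlowChart
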